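import Literature.Analysis.FluidPDE.Tao2016AveragedNS.DelayCircuit
import HarnessLib

/-!
# Tao 2016, §5.5 with the squared modes DOUBLED: the square-free ("split") delay circuit, its
# gates, its exact reduction to (5.5) on the swap-invariant diagonal, and the asymmetry equations

T. Tao, *Finite time blowup for an averaged three-dimensional Navier–Stokes equation*, J. Amer.
Math. Soc. **29** (2016) 601–674 = arXiv:1402.0290v3, §5.1–§5.5 (the gates and the five-mode delay
circuit (5.5)–(5.6), p. 28), read together with §3.2 p. 15 ("it is necessary to ensure that
`ξ⁰₁, ξ⁰₂, ξ⁰₃` have distinct magnitudes in order to avoid … the failure of (c-nondeg)"), the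
footnote of §1 p. 6 ("without [dilation averaging] the non-degeneracy condition (c-nondeg) failed")
and Remark 3.5 p. 20 ("As there is some freedom to select the local cascade operators in Theorem 3.3,
this should still be enough [to drop the dilation averaging]"). [`Tao2016AveragedNS`]

HONEST FRAMING (cell harvest/h2-tao-ladder, rung 1 of a ladder of MODEL equations; LADDER.md §2.1
(A-1.3)/(A-1.3b) and referee/PASS-FAIL.md «Cycle 2»): everything in this file is finite-dimensional,
elementary algebra about Tao's TOY circuit (5.5) and a nine-mode VARIANT of it in which every mode
that enters (5.5) through its SQUARE is replaced by a pair of modes entering through their PRODUCT.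
No dynamics is proved here (no analogue of Theorem 5.3 for the variant is claimed), no named fact is
declared, and nothing in this file concerns the Navier–Stokes equations.

## Why the squares matter (the printed reason, and the tree's coefficient lemmas)

In the cascade operator (4.1)/(6.1)–(6.4) a monomial `X_{i,n}²` is a basic cascade term whose two
INPUT profiles coincide, hence have equal centre modulus; without dilation averaging the Fourier
inversion of §3.9 is then unavailable, because four of the eight coefficients `c_σ` of (3.24) vanish
identically on the equal-input-moduli locus (tree: `Tao2016.cSigma_eq_zero_of_isosceles`; conversely
`cSigma_ne_zero_of_triangle` off it — `TaoAveragedIsoscelesDegeneracy.lean`). The squares of (5.5) are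
exactly the pump `εa² → b`, the seed pump `ε²e^{-K¹⁰}a² → c`, the amplifier drain `-ε⁻¹K¹⁰c² → b` and
the output pump `Kd² → ã`; the rotor `ε⁻²c∘(a,d)` has none. Doubling `a, c, d, ã` into swap-pairs
`(a′,a″), (c′,c″), (d′,d″), (ã′,ã″)` and letting the energy identity dictate the couplings gives the
SQUARE-FREE circuit below (every monomial is a product of two DIFFERENT modes). Whether Tao's
Theorem 5.3 / Theorem 6.2 survive the doubling is the cell's open obligation "R1-b"; this file only
supplies the exact algebra that obligation is about.

## Contents (all kernel-checked, proofs by `ring` modulo `(√2)² = 2`)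

* Gates: `crossPumpOn κ i i′ j` (`∂Xᵢ = -κXᵢ′Xⱼ`, `∂Xᵢ′ = -κXᵢXⱼ`, `∂Xⱼ = 2κXᵢXᵢ′` — the square-free
  pump) and `splitAmplifierOn κ i j j′` (`∂Xᵢ = -2κXⱼXⱼ′`, `∂Xⱼ = κXᵢXⱼ′`, `∂Xⱼ′ = κXᵢXⱼ`); both
  cancel; the ENERGY IDENTITY FORCES THE CROSS FORM (`crossForm_forced`: a pump-type gate
  `{i,i′ → j}` with no `Xᵢ²`, `Xᵢ′²` inputs cancels only if the self-couplings `XᵢXⱼ → ∂Xᵢ`,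
  `Xᵢ′Xⱼ → ∂Xᵢ′` vanish and the three cross couplings sum to zero).
* `splitDelayCircuit K ε` on modes `(a′,a″,b,c′,c″,d′,d″,ã′,ã″) ↦ 0,…,8`, `= ` the sum of eight
  gates (`splitDelayCircuit_eq_gates`), cancelling (`isCancelling_splitDelayCircuit`), SQUARE-FREE
  (`isSquareFree_splitDelayCircuit`: it vanishes on every coordinate axis), whereas (5.5) is not
  (`not_isSquareFree_delayCircuit`). Consequence typed: NO IGNITION FROM A SINGLE MODE — every state
  supported on one mode is an equilibrium (`splitDelayCircuit_single`), so the datum of a square-free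
  circuit must load both copies `a′, a″` (Tao's (5.6) loads the one mode `a`).
* The swap-symmetric / antisymmetric coordinates `symPart X = ((a′+a″)/√2, b, (c′+c″)/√2, (d′+d″)/√2,
  (ã′+ã″)/√2)`, `asymPart X = ((a′-a″)/√2, (c′-c″)/√2, (d′-d″)/√2, (ã′-ã″)/√2)` and the diagonal
  embedding `diagEmbed S` (`x′ = x″ = x/√2`): energy splits (`energy_eq_symPart_add_asymPart`,
  `energy_diagEmbed`).
* EXACT REDUCTION: `symPart (F♯ X) = (5.5)(symPart X) + Q(asymPart X)` with `Q` QUADRATIC in the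
  asymmetries (`symPart_splitDelayCircuit`, `symCorrection`: `+ε⁻²Y_cY_d`, `-εY_a² + ε⁻¹K¹⁰Y_c²`,
  `-ε²e^{-K¹⁰}Y_a²`, `-ε⁻²Y_aY_c`, `-KY_d²`), and `asymPart (F♯ X) = L_{symPart X}(asymPart X)` LINEAR
  in the asymmetries (`asymPart_splitDelayCircuit`, `asymField`: `∂Y_a = εbY_a + ε²e^{-K¹⁰}S_cY_a
  - ε⁻²S_cY_d + ε⁻²S_dY_c`, `∂Y_c = -ε⁻¹K¹⁰ b Y_c`, `∂Y_d = ε⁻²S_cY_a - ε⁻²S_aY_c + K S_ã Y_d`,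
  `∂Y_ã = 0`). Hence the diagonal `asymPart = 0` is invariant and carries (5.5) EXACTLY
  (`splitDelayCircuit_diagEmbed`, `hasDerivAt_diagEmbed`: a solution of (5.5) embeds as a solution of
  the split circuit with the datum `diagEmbed delayInit = (1/√2, 1/√2, 0, …, 0)`).
* The gate-by-gate invariants, INCLUDING THE TWO THAT FAIL (referee cycle 2, check (4)): a single
  cross pump conserves `Xᵢ² - Xᵢ′²` (`crossPumpOn_inputSq_sub`) and a split amplifier conserves
  `Xⱼ² - Xⱼ′²` (`splitAmplifierOn_pairSq_sub`); two cross pumps with common inputs and outputs `j ≠ j′`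
  (the seed, the hand-off) conserve the output DIFFERENCE `Xⱼ - Xⱼ′` (`seedPair_output_sub`) but NOT
  `Xⱼ² - Xⱼ′²` (`seedPair_outputSq_sub`: rate `2κXᵢXᵢ′(Xⱼ - Xⱼ′)`); and the HAND-OFF INSTABILITY: under
  a cross pump the antisymmetric input combination grows at rate `κXⱼ` while the symmetric one decays
  at the same rate (`crossPumpOn_input_sub`, `crossPumpOn_input_add`) — in the circuit, `∂(d′-d″) ∋
  +K S_ã (d′-d″)` while `ã` is loaded: the square-free output pump is a two-way gate off the diagonal.

## References

* T. Tao, J. Amer. Math. Soc. 29 (2016) 601–674 = arXiv:1402.0290v3: §5.1 (pump), §5.3 (amp),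
  §5.4 (rotor-def), §5.5 (5.5)–(5.6) p. 28; §3.2 p. 15; §1 footnote p. 6; Remark 3.5 p. 20;
  §6.1 (6.1)–(6.4) p. 31. Key `Tao2016AveragedNS`.
-/

noncomputable section

namespace Literature.Analysis.FluidPDE.Tao2016AveragedNS

variable {m : ℕ}

/-! ## Square-free gates -/

/-- The **cross pump** of coupling `κ` with inputs `i, i′` and output `j` inside an `m`-mode circuit:
`-κ Xᵢ′ Xⱼ` to `∂ₜXᵢ`, `-κ Xᵢ Xⱼ` to `∂ₜXᵢ′`, `2κ Xᵢ Xᵢ′` to `∂ₜXⱼ` — Tao's pump `{i,i → j}` (§5.1: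
`∂ₜx = -αxy`, `∂ₜy = αx²`) with the squared input replaced by the product of two modes; on the
diagonal `Xᵢ = Xᵢ′ = x/√2` it is the pump of coupling `κ` acting on `(x, Xⱼ)`.
[cite: Tao2016AveragedNS, §5.1 (pump)] -/
def crossPumpOn (κ : ℝ) (i i' j : Fin m) (X : Fin m → ℝ) : Fin m → ℝ :=
  Pi.single i (-(κ * X i' * X j)) + Pi.single i' (-(κ * X i * X j)) +
    Pi.single j (2 * κ * X i * X i')

/-- The **split amplifier** of coupling `κ` in which the driver `i` amplifies the PAIR `(j, j′)`:
`-2κ Xⱼ Xⱼ′` to `∂ₜXᵢ`, `κ Xᵢ Xⱼ′` to `∂ₜXⱼ`, `κ Xᵢ Xⱼ` to `∂ₜXⱼ′` — Tao's amplifier (§5.3: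
`∂ₜx = -αy²`, `∂ₜy = αxy`) with `y²` replaced by `XⱼXⱼ′`; on the diagonal `Xⱼ = Xⱼ′ = y/√2` it is the
amplifier of coupling `κ`. [cite: Tao2016AveragedNS, §5.3 (amp)] -/
def splitAmplifierOn (κ : ℝ) (i j j' : Fin m) (X : Fin m → ℝ) : Fin m → ℝ :=
  Pi.single i (-(2 * κ * X j * X j')) + Pi.single j (κ * X i * X j') + Pi.single j' (κ * X i * X j)

/-- `∑ₗ (δᵢ(a) + δⱼ(b) + δₖ(c))ₗ Xₗ = a Xᵢ + b Xⱼ + c Xₖ`. [folklore] -/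
private theorem sum_single_add_single_add_single_mul (i j k : Fin m) (a b c : ℝ) (X : Fin m → ℝ) :
    ∑ l, (Pi.single i a + Pi.single j b + Pi.single k c : Fin m → ℝ) l * X l =
      a * X i + b * X j + c * X k := by
  simp [Pi.single_apply, Finset.sum_add_distrib, add_mul, ite_mul]

/-- A cross pump cancels (`-κXᵢ′XⱼXᵢ - κXᵢXⱼXᵢ′ + 2κXᵢXᵢ′Xⱼ = 0`). [cite: Tao2016AveragedNS, §5.1] -/
theorem isCancelling_crossPumpOn (κ : ℝ) (i i' j : Fin m) : IsCancelling (crossPumpOn κ i i' j) := by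
  intro X
  rw [crossPumpOn, sum_single_add_single_add_single_mul]
  ring

/-- A split amplifier cancels. [cite: Tao2016AveragedNS, §5.3] -/
theorem isCancelling_splitAmplifierOn (κ : ℝ) (i j j' : Fin m) :
    IsCancelling (splitAmplifierOn κ i j j') := by
  intro X
  rw [splitAmplifierOn, sum_single_add_single_add_single_mul]
  ring

/-- **The energy identity forces the cross form.** A quadratic gate on three modes `(x′, x″, y) =
(X 0, X 1, X 2)` of pump type — `y` fed by the product `x′x″` (coupling `α`), `x′` fed by `x′y` and
`x″y` (couplings `β, γ`), `x″` fed by `x″y` and `x′y` (couplings `β′, γ′`), no squares — cancels for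
all states if and only if the self-couplings vanish, `β = β′ = 0`, and `α + γ + γ′ = 0`. (The swap-
symmetric choice `γ = γ′ = -κ`, `α = 2κ` is `crossPumpOn κ 0 1 2`.)
[cite: Tao2016AveragedNS, §5 (g-cancel) and §5.1] -/
theorem crossForm_forced (α β γ β' γ' : ℝ) :
    IsCancelling (fun X : Fin 3 → ℝ =>
      ![β * X 0 * X 2 + γ * X 1 * X 2, β' * X 1 * X 2 + γ' * X 0 * X 2, α * X 0 * X 1]) ↔
      β = 0 ∧ β' = 0 ∧ α + γ + γ' = 0 := by
  constructor
  · intro h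
    have h1 := h ![1, 0, 1]
    have h2 := h ![0, 1, 1]
    have h3 := h ![1, 1, 1]
    simp [Fin.sum_univ_three] at h1 h2 h3
    refine ⟨h1, h2, ?_⟩
    linear_combination h3 - h1 - h2
  · rintro ⟨hβ, hβ', hα⟩ X
    have hα' : α = -γ - γ' := by linear_combination hα
    subst hβ hβ' hα'
    simp [Fin.sum_univ_three]
    ring

/-! ## The split delay circuit on nine modes -/

/-- **The split (square-free) delay circuit** with parameters `K` (large) and `ε` (small), modes
`(a′,a″,b,c′,c″,d′,d″,ã′,ã″) = (X 0, …, X 8)`: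
`∂ₜa′ = -√2ε⁻² c″d′ - ε a″b - (ε²e^{-K¹⁰}/√2) a″(c′+c″)`, `∂ₜa″ =` (swap `′ ↔ ″`),
`∂ₜb = 2ε a′a″ - 2ε⁻¹K¹⁰ c′c″`, `∂ₜc′ = √2 ε²e^{-K¹⁰} a′a″ + ε⁻¹K¹⁰ b c″`, `∂ₜc″ =` (swap),
`∂ₜd′ = √2ε⁻² c″a′ - (K/√2) d″(ã′+ã″)`, `∂ₜd″ =` (swap), `∂ₜã′ = ∂ₜã″ = √2 K d′d″`
(`1/√2` written `√2/2`). Tao's (5.5) is recovered on the diagonal `x′ = x″ = x/√2`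
(`splitDelayCircuit_diagEmbed`). [cite: Tao2016AveragedNS, §5.5 (5.5)] -/
def splitDelayCircuit (K ε : ℝ) (X : Fin 9 → ℝ) : Fin 9 → ℝ :=
  ![-(Real.sqrt 2 * (ε ^ 2)⁻¹ * X 4 * X 5) - ε * X 1 * X 2 -
      Real.sqrt 2 / 2 * (ε ^ 2 * Real.exp (-K ^ 10)) * X 1 * X 3 -
      Real.sqrt 2 / 2 * (ε ^ 2 * Real.exp (-K ^ 10)) * X 1 * X 4,
    -(Real.sqrt 2 * (ε ^ 2)⁻¹ * X 3 * X 6) - ε * X 0 * X 2 -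
      Real.sqrt 2 / 2 * (ε ^ 2 * Real.exp (-K ^ 10)) * X 0 * X 3 -
      Real.sqrt 2 / 2 * (ε ^ 2 * Real.exp (-K ^ 10)) * X 0 * X 4,
    2 * ε * X 0 * X 1 - 2 * (ε⁻¹ * K ^ 10) * X 3 * X 4,
    2 * (Real.sqrt 2 / 2 * (ε ^ 2 * Real.exp (-K ^ 10))) * X 0 * X 1 + ε⁻¹ * K ^ 10 * X 2 * X 4,
    2 * (Real.sqrt 2 / 2 * (ε ^ 2 * Real.exp (-K ^ 10))) * X 0 * X 1 + ε⁻¹ * K ^ 10 * X 2 * X 3,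
    Real.sqrt 2 * (ε ^ 2)⁻¹ * X 0 * X 4 - Real.sqrt 2 / 2 * K * X 6 * X 7 -
      Real.sqrt 2 / 2 * K * X 6 * X 8,
    Real.sqrt 2 * (ε ^ 2)⁻¹ * X 1 * X 3 - Real.sqrt 2 / 2 * K * X 5 * X 7 -
      Real.sqrt 2 / 2 * K * X 5 * X 8,
    2 * (Real.sqrt 2 / 2 * K) * X 5 * X 6,
    2 * (Real.sqrt 2 / 2 * K) * X 5 * X 6]

/-- **The split circuit is the superposition of eight square-free gates**: cross pump `ε : (a′,a″) → b`
(the clock), cross pumps `ε²e^{-K¹⁰}/√2 : (a′,a″) → c′` and `→ c″` (the seed), split amplifier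
`ε⁻¹K¹⁰ : b ⇒ (c′,c″)`, rotors `√2ε⁻² : c″ ∘ (a′,d′)` and `c′ ∘ (a″,d″)` (Tao's rotor gate, which is
already square-free), cross pumps `K/√2 : (d′,d″) → ã′` and `→ ã″` (the hand-off).
[cite: Tao2016AveragedNS, §5.5] -/
theorem splitDelayCircuit_eq_gates (K ε : ℝ) :
    splitDelayCircuit K ε =
      crossPumpOn ε 0 1 2 +
        crossPumpOn (Real.sqrt 2 / 2 * (ε ^ 2 * Real.exp (-K ^ 10))) 0 1 3 +
        crossPumpOn (Real.sqrt 2 / 2 * (ε ^ 2 * Real.exp (-K ^ 10))) 0 1 4 +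
        splitAmplifierOn (ε⁻¹ * K ^ 10) 2 3 4 +
        rotorOn (Real.sqrt 2 * (ε ^ 2)⁻¹) 0 5 4 + rotorOn (Real.sqrt 2 * (ε ^ 2)⁻¹) 1 6 3 +
        crossPumpOn (Real.sqrt 2 / 2 * K) 5 6 7 + crossPumpOn (Real.sqrt 2 / 2 * K) 5 6 8 := by
  funext X; ext l
  fin_cases l <;> simp [splitDelayCircuit, crossPumpOn, splitAmplifierOn, rotorOn] <;> ring

/-- The split circuit obeys the cancellation (g-cancel), gate by gate. [cite: Tao2016AveragedNS, §5.5] -/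
theorem isCancelling_splitDelayCircuit (K ε : ℝ) : IsCancelling (splitDelayCircuit K ε) := by
  rw [splitDelayCircuit_eq_gates]
  exact (((((((isCancelling_crossPumpOn _ _ _ _).add (isCancelling_crossPumpOn _ _ _ _)).add
    (isCancelling_crossPumpOn _ _ _ _)).add (isCancelling_splitAmplifierOn _ _ _ _)).add
    (isCancelling_rotorOn _ _ _ _)).add (isCancelling_rotorOn _ _ _ _)).add
    (isCancelling_crossPumpOn _ _ _ _)).add (isCancelling_crossPumpOn _ _ _ _)

/-- Energy conservation along any trajectory of the split circuit. [cite: Tao2016AveragedNS, §5 (ode)] -/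
theorem splitDelayCircuit_energy {K ε : ℝ} {X : ℝ → Fin 9 → ℝ}
    (hX : ∀ t, HasDerivAt X (splitDelayCircuit K ε (X t)) t) (t t₀ : ℝ) :
    energy (X t) = energy (X t₀) :=
  energy_eq_of_isCancelling (isCancelling_splitDelayCircuit K ε) hX t t₀

/-! ## Square-freeness and "no ignition from a single mode" -/

/-- A homogeneous-quadratic circuit field is **square-free** when it vanishes on every coordinate
axis: no component contains a monomial `Xᵢ²` (a cross monomial `XᵢXⱼ`, `i ≠ j`, vanishes on the axes).
In the cascade dictionary of §4/§6.1 a square is a basic term with coinciding input profiles.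
[cite: Tao2016AveragedNS, §4 (4.1) and §3.2 p. 15] -/
def IsSquareFree (F : (Fin m → ℝ) → (Fin m → ℝ)) : Prop :=
  ∀ (i : Fin m) (x : ℝ), F (Pi.single i x) = 0

/-- **The split circuit is square-free.** [cite: Tao2016AveragedNS, §5.5 and §3.2 p. 15] -/
theorem isSquareFree_splitDelayCircuit (K ε : ℝ) : IsSquareFree (splitDelayCircuit K ε) := by
  intro i x
  ext l
  fin_cases i <;> fin_cases l <;> simp [splitDelayCircuit]

/-- **Tao's (5.5) is not square-free** (for `ε ≠ 0`): at the datum (5.6) `a = 1` the clock starts,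
`∂ₜb = ε ≠ 0`. [cite: Tao2016AveragedNS, §5.5 (5.5)–(5.6)] -/
theorem not_isSquareFree_delayCircuit {K ε : ℝ} (hε : ε ≠ 0) : ¬ IsSquareFree (delayCircuit K ε) := by
  intro h
  have h1 := congrFun (h 0 1) 1
  simp [delayCircuit] at h1
  exact hε h1

/-- **No ignition from a single mode**: every state of the split circuit supported on one mode is an
equilibrium. In particular the datum `a′ = 1` (one copy of Tao's (5.6)) produces no transfer at all —
the datum of a square-free circuit must load at least two modes (here: both copies, `diagEmbed
delayInit`). [cite: Tao2016AveragedNS, §5.5 (5.6)] -/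
theorem splitDelayCircuit_single (K ε : ℝ) (i : Fin 9) (x : ℝ) :
    splitDelayCircuit K ε (Pi.single i x) = 0 :=
  isSquareFree_splitDelayCircuit K ε i x

/-! ## Symmetric / antisymmetric coordinates and the diagonal -/

/-- The **swap-symmetric part** `S = ((a′+a″)/√2, b, (c′+c″)/√2, (d′+d″)/√2, (ã′+ã″)/√2)` of a split
state, in the mode order `(a,b,c,d,ã)` of (5.5). [cite: Tao2016AveragedNS, §5.5 (5.5)] -/
def symPart (X : Fin 9 → ℝ) : Fin 5 → ℝ :=
  ![Real.sqrt 2 / 2 * (X 0 + X 1), X 2, Real.sqrt 2 / 2 * (X 3 + X 4),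
    Real.sqrt 2 / 2 * (X 5 + X 6), Real.sqrt 2 / 2 * (X 7 + X 8)]

/-- The **swap-antisymmetric part** `Y = ((a′-a″)/√2, (c′-c″)/√2, (d′-d″)/√2, (ã′-ã″)/√2)` of a split
state (the unsplit mode `b` has none). [cite: Tao2016AveragedNS, §5.5 (5.5)] -/
def asymPart (X : Fin 9 → ℝ) : Fin 4 → ℝ :=
  ![Real.sqrt 2 / 2 * (X 0 - X 1), Real.sqrt 2 / 2 * (X 3 - X 4), Real.sqrt 2 / 2 * (X 5 - X 6),
    Real.sqrt 2 / 2 * (X 7 - X 8)]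

/-- The **diagonal embedding** of a five-mode state: each doubled mode carries `x′ = x″ = x/√2`
(so that `x′² + x″² = x²`), `b` is copied. [cite: Tao2016AveragedNS, §5.5 (5.5)] -/
def diagEmbed (S : Fin 5 → ℝ) : Fin 9 → ℝ :=
  ![Real.sqrt 2 / 2 * S 0, Real.sqrt 2 / 2 * S 0, S 1, Real.sqrt 2 / 2 * S 2, Real.sqrt 2 / 2 * S 2,
    Real.sqrt 2 / 2 * S 3, Real.sqrt 2 / 2 * S 3, Real.sqrt 2 / 2 * S 4, Real.sqrt 2 / 2 * S 4]

/-- The **quadratic correction** to the symmetric equations, a function of the asymmetries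
`Y = (Y_a, Y_c, Y_d, Y_ã)` only: `(+ε⁻²Y_cY_d, -εY_a² + ε⁻¹K¹⁰Y_c², -ε²e^{-K¹⁰}Y_a², -ε⁻²Y_aY_c, -KY_d²)`.
[cite: Tao2016AveragedNS, §5.5 (5.5)] -/
def symCorrection (K ε : ℝ) (Y : Fin 4 → ℝ) : Fin 5 → ℝ :=
  ![(ε ^ 2)⁻¹ * Y 1 * Y 2, -(ε * Y 0 ^ 2) + ε⁻¹ * K ^ 10 * Y 1 ^ 2,
    -(ε ^ 2 * Real.exp (-K ^ 10) * Y 0 ^ 2), -((ε ^ 2)⁻¹ * Y 0 * Y 1), -(K * Y 2 ^ 2)]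

/-- The **asymmetry field**: the antisymmetric equations are LINEAR in `Y` with coefficients read off
the symmetric state `S = (S_a, b, S_c, S_d, S_ã)`:
`∂Y_a = εbY_a + ε²e^{-K¹⁰}S_cY_a - ε⁻²S_cY_d + ε⁻²S_dY_c` (clock and seed UNDO on `Y_a` what they do
to `S_a`; the rotor turns `(Y_a,Y_d)` at speed `ε⁻²S_c` and forces it by `ε⁻²Y_c(S_d,-S_a)` — the
phase slip of the two rotor planes), `∂Y_c = -ε⁻¹K¹⁰ b Y_c` (damped while `b > 0`, the seed does not
feed it), `∂Y_d = ε⁻²S_cY_a - ε⁻²S_aY_c + K S_ã Y_d` (GROWS at rate `K S_ã` under the hand-off),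
`∂Y_ã = 0` (the next level is born symmetric). [cite: Tao2016AveragedNS, §5.5 (5.5)] -/
def asymField (K ε : ℝ) (S : Fin 5 → ℝ) (Y : Fin 4 → ℝ) : Fin 4 → ℝ :=
  ![ε * S 1 * Y 0 + ε ^ 2 * Real.exp (-K ^ 10) * S 2 * Y 0 - (ε ^ 2)⁻¹ * S 2 * Y 2 +
      (ε ^ 2)⁻¹ * S 3 * Y 1,
    -(ε⁻¹ * K ^ 10 * S 1 * Y 1),
    (ε ^ 2)⁻¹ * S 2 * Y 0 - (ε ^ 2)⁻¹ * S 0 * Y 1 + K * S 4 * Y 2,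
    0]

/-- `(√2)² = 2`. [folklore] -/
private theorem sqrt_two_sq : Real.sqrt 2 ^ 2 = 2 := Real.sq_sqrt (by norm_num)

/-- The symmetric part of a diagonal state is the state (`x′ = x″ = x/√2 ⇒ (x′+x″)/√2 = x`).
[cite: Tao2016AveragedNS, §5.5 (5.5)] -/
@[simp]
theorem symPart_diagEmbed (S : Fin 5 → ℝ) : symPart (diagEmbed S) = S := by
  ext l
  fin_cases l <;> simp [symPart, diagEmbed] <;> ring_nf <;> simp <;> ring

/-- A diagonal state has no asymmetry. [cite: Tao2016AveragedNS, §5.5 (5.5)] -/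
@[simp]
theorem asymPart_diagEmbed (S : Fin 5 → ℝ) : asymPart (diagEmbed S) = 0 := by
  ext l
  fin_cases l <;> simp [asymPart, diagEmbed]

/-- A state with no asymmetry is the diagonal embedding of its symmetric part (the diagonal of the
doubled (5.5) is parametrised by the five modes of (5.5)). [cite: Tao2016AveragedNS, §5.5 (5.5)] -/
theorem diagEmbed_symPart {X : Fin 9 → ℝ} (h : asymPart X = 0) : diagEmbed (symPart X) = X := by
  have h0 : X 0 = X 1 := by
    have := congrFun h 0; simp [asymPart] at this; linarith
  have h3 : X 3 = X 4 := by
    have := congrFun h 1; simp [asymPart] at this; linarith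
  have h5 : X 5 = X 6 := by
    have := congrFun h 2; simp [asymPart] at this; linarith
  have h7 : X 7 = X 8 := by
    have := congrFun h 3; simp [asymPart] at this; linarith
  ext l
  fin_cases l <;> simp [symPart, diagEmbed, h0, h3, h5, h7] <;> ring_nf <;> simp <;> ring

/-- **The energy splits**: `|X|² = |symPart X|² + |asymPart X|²` (`x′² + x″² = S_x² + Y_x²`).
[cite: Tao2016AveragedNS, §5 (ode)] -/
theorem energy_eq_symPart_add_asymPart (X : Fin 9 → ℝ) :
    energy X = energy (symPart X) + energy (asymPart X) := by
  simp only [energy, symPart, asymPart, Fin.sum_univ_succ, Fin.sum_univ_zero]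
  simp
  ring_nf
  simp

/-- The diagonal embedding preserves the energy. [cite: Tao2016AveragedNS, §5 (ode)] -/
theorem energy_diagEmbed (S : Fin 5 → ℝ) : energy (diagEmbed S) = energy S := by
  rw [energy_eq_symPart_add_asymPart, symPart_diagEmbed, asymPart_diagEmbed]
  simp [energy]

/-! ## The exact reduction: symmetric part = (5.5) + quadratic, antisymmetric part = linear -/

/-- **The symmetric equations are Tao's (5.5) up to corrections quadratic in the asymmetries**:
`symPart (F♯ X) = delayCircuit K ε (symPart X) + symCorrection K ε (asymPart X)`. In the variables
`S_x = (x′+x″)/√2`, `Y_x = (x′-x″)/√2` one has `2x′x″ = S_x² - Y_x²` and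
`c″d′ + c′d″ = S_cS_d - Y_cY_d`, which is all this says. [cite: Tao2016AveragedNS, §5.5 (5.5)] -/
theorem symPart_splitDelayCircuit (K ε : ℝ) (X : Fin 9 → ℝ) :
    symPart (splitDelayCircuit K ε X) =
      delayCircuit K ε (symPart X) + symCorrection K ε (asymPart X) := by
  ext l
  fin_cases l
  · simp [symPart, asymPart, splitDelayCircuit, delayCircuit, symCorrection]; ring_nf
  · simp [symPart, asymPart, splitDelayCircuit, delayCircuit, symCorrection]; ring_nf; simp
  · simp [symPart, asymPart, splitDelayCircuit, delayCircuit, symCorrection]; ring_nf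
  · simp [symPart, asymPart, splitDelayCircuit, delayCircuit, symCorrection]; ring_nf
  · simp [symPart, asymPart, splitDelayCircuit, delayCircuit, symCorrection]; ring_nf

/-- **The antisymmetric equations are linear in the asymmetries**:
`asymPart (F♯ X) = asymField K ε (symPart X) (asymPart X)`. [cite: Tao2016AveragedNS, §5.5 (5.5)] -/
theorem asymPart_splitDelayCircuit (K ε : ℝ) (X : Fin 9 → ℝ) :
    asymPart (splitDelayCircuit K ε X) = asymField K ε (symPart X) (asymPart X) := by
  ext l
  fin_cases l <;> simp [symPart, asymPart, splitDelayCircuit, asymField] <;> ring_nf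

/-- The correction to (5.5) vanishes when there is no asymmetry. [cite: Tao2016AveragedNS, §5.5 (5.5)] -/
@[simp]
theorem symCorrection_zero (K ε : ℝ) : symCorrection K ε 0 = 0 := by
  ext l; fin_cases l <;> simp [symCorrection]

/-- The asymmetry field of the doubled (5.5) vanishes when there is no asymmetry (it is linear in
`Y`). [cite: Tao2016AveragedNS, §5.5 (5.5)] -/
@[simp]
theorem asymField_zero (K ε : ℝ) (S : Fin 5 → ℝ) : asymField K ε S 0 = 0 := by
  ext l; fin_cases l <;> simp [asymField]

/-- **The diagonal is invariant and carries (5.5) exactly**: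
`F♯ (diagEmbed S) = diagEmbed (delayCircuit K ε S)`. [cite: Tao2016AveragedNS, §5.5 (5.5)] -/
theorem splitDelayCircuit_diagEmbed (K ε : ℝ) (S : Fin 5 → ℝ) :
    splitDelayCircuit K ε (diagEmbed S) = diagEmbed (delayCircuit K ε S) := by
  have hY : asymPart (splitDelayCircuit K ε (diagEmbed S)) = 0 := by
    rw [asymPart_splitDelayCircuit, asymPart_diagEmbed, asymField_zero]
  rw [← diagEmbed_symPart hY, symPart_splitDelayCircuit, symPart_diagEmbed, asymPart_diagEmbed,
    symCorrection_zero, add_zero]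

/-- **A trajectory of (5.5) embeds diagonally as a trajectory of the split circuit** (in particular
Tao's solution from (5.6) gives the split solution from the symmetric datum `diagEmbed delayInit`).
No converse stability is claimed. [cite: Tao2016AveragedNS, §5.5 (5.5)–(5.6)] -/
theorem hasDerivAt_diagEmbed {K ε : ℝ} {S : ℝ → Fin 5 → ℝ} {t : ℝ}
    (hS : HasDerivAt S (delayCircuit K ε (S t)) t) :
    HasDerivAt (fun s => diagEmbed (S s)) (splitDelayCircuit K ε (diagEmbed (S t))) t := by
  rw [splitDelayCircuit_diagEmbed]
  have h := hasDerivAt_pi.1 hS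
  refine hasDerivAt_pi.2 fun l => ?_
  fin_cases l
  all_goals simp only [diagEmbed, Fin.zero_eta, Fin.isValue, Matrix.cons_val_zero,
    Matrix.cons_val_one, Fin.mk_one, Fin.reduceFinMk, Matrix.cons_val]
  all_goals first
    | exact (h _).const_mul _
    | exact h _

/-- The symmetric datum: both copies of `a` loaded with `1/√2`, energy `1`.
[cite: Tao2016AveragedNS, §5.5 (5.6)] -/
theorem energy_diagEmbed_delayInit : energy (diagEmbed delayInit) = 1 := by
  rw [energy_diagEmbed]
  simp [energy, delayInit, Fin.sum_univ_five]

/-! ## Gate-by-gate invariants, including the two that fail -/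

/-- **A single cross pump conserves the difference of the input squares** `Xᵢ² - Xᵢ′²`
(`Xᵢ·∂Xᵢ - Xᵢ′·∂Xᵢ′ = 0`): so the clock pump conserves `a′² - a″²` and each seed/hand-off pump does too
on its INPUT side. [cite: Tao2016AveragedNS, §5.1 (pump)] -/
theorem crossPumpOn_inputSq_sub (κ : ℝ) {i i' j : Fin m} (hii' : i ≠ i') (hij : i ≠ j)
    (hi'j : i' ≠ j) (X : Fin m → ℝ) :
    X i * crossPumpOn κ i i' j X i - X i' * crossPumpOn κ i i' j X i' = 0 := by
  simp [crossPumpOn, hii', hij, hi'j, hii'.symm]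
  ring

/-- **Under a cross pump the antisymmetric input combination grows at rate `κXⱼ`**:
`∂(Xᵢ - Xᵢ′) = κ Xⱼ (Xᵢ - Xᵢ′)` — with `κ = K/√2` per output copy and `Xⱼ = ã′, ã″` loaded this is the
hand-off instability `∂(d′-d″) = K S_ã (d′-d″)` of the split circuit. [cite: Tao2016AveragedNS, §5.1 (pump)] -/
theorem crossPumpOn_input_sub (κ : ℝ) {i i' j : Fin m} (hii' : i ≠ i') (hij : i ≠ j)
    (hi'j : i' ≠ j) (X : Fin m → ℝ) :
    crossPumpOn κ i i' j X i - crossPumpOn κ i i' j X i' = κ * X j * (X i - X i') := by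
  simp [crossPumpOn, hii', hij, hi'j, hii'.symm]
  ring

/-- **… while the symmetric input combination decays at the same rate**:
`∂(Xᵢ + Xᵢ′) = -κ Xⱼ (Xᵢ + Xᵢ′)`. [cite: Tao2016AveragedNS, §5.1 (pump)] -/
theorem crossPumpOn_input_add (κ : ℝ) {i i' j : Fin m} (hii' : i ≠ i') (hij : i ≠ j)
    (hi'j : i' ≠ j) (X : Fin m → ℝ) :
    crossPumpOn κ i i' j X i + crossPumpOn κ i i' j X i' = -(κ * X j * (X i + X i')) := by
  simp [crossPumpOn, hii', hij, hi'j, hii'.symm]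
  ring

/-- **A split amplifier conserves the difference of the pair's squares** `Xⱼ² - Xⱼ′²`.
[cite: Tao2016AveragedNS, §5.3 (amp)] -/
theorem splitAmplifierOn_pairSq_sub (κ : ℝ) {i j j' : Fin m} (hij : i ≠ j) (hij' : i ≠ j')
    (hjj' : j ≠ j') (X : Fin m → ℝ) :
    X j * splitAmplifierOn κ i j j' X j - X j' * splitAmplifierOn κ i j j' X j' = 0 := by
  simp [splitAmplifierOn, hjj', hij.symm, hij'.symm, hjj'.symm]
  ring

/-- **Two cross pumps with common inputs feed their two outputs identically**: the output difference
`Xⱼ - Xⱼ′` is invariant (the seed does not create `Y_c`; the hand-off gives birth to a symmetric next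
level, `∂Y_ã = 0`). [cite: Tao2016AveragedNS, §5.1 (pump)] -/
theorem seedPair_output_sub (κ : ℝ) {i i' j j' : Fin m} (hij : i ≠ j) (hij' : i ≠ j')
    (hi'j : i' ≠ j) (hi'j' : i' ≠ j') (hjj' : j ≠ j') (X : Fin m → ℝ) :
    (crossPumpOn κ i i' j + crossPumpOn κ i i' j') X j -
      (crossPumpOn κ i i' j + crossPumpOn κ i i' j') X j' = 0 := by
  simp [crossPumpOn, hjj', hij.symm, hij'.symm, hi'j.symm, hi'j'.symm, hjj'.symm]

/-- **… but NOT the difference of the output squares**: `Xⱼ∂Xⱼ - Xⱼ′∂Xⱼ′ = 2κXᵢXᵢ′(Xⱼ - Xⱼ′)`, which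
vanishes only on the diagonal `Xⱼ = Xⱼ′` (the correction to check (4) of LADDER (A-1.3b): the seed
does not conserve `c′² - c″²`, the hand-off does not conserve `ã′² - ã″²`).
[cite: Tao2016AveragedNS, §5.1 (pump)] -/
theorem seedPair_outputSq_sub (κ : ℝ) {i i' j j' : Fin m} (hij : i ≠ j) (hij' : i ≠ j')
    (hi'j : i' ≠ j) (hi'j' : i' ≠ j') (hjj' : j ≠ j') (X : Fin m → ℝ) :
    X j * (crossPumpOn κ i i' j + crossPumpOn κ i i' j') X j -
      X j' * (crossPumpOn κ i i' j + crossPumpOn κ i i' j') X j' =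
        2 * κ * X i * X i' * (X j - X j') := by
  simp [crossPumpOn, hjj', hij.symm, hij'.symm, hi'j.symm, hi'j'.symm, hjj'.symm]
  ring

end Literature.Analysis.FluidPDE.Tao2016AveragedNS
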